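import Literature.Probability.RandomPlanarGeometry.SLECardyFlow
import Literature.Probability.RandomPlanarGeometry.CardyFunctionIncBeta
import Literature.Analysis.Calculus.SmoothIntervalExtension
import Literature.Analysis.FunctionSpaces.ItoFormulaProgressive
import HarnessLib

/-!
# Itô's formula for Cardy's observable of the SLE_κ flow: `F(η_{t∧ρ}) - ∫₀^{t∧ρ} 𝓛_κ ds` is a martingale

Topic `Probability/RandomPlanarGeometry`; theorems (and two auxiliary real-valued definitions)
only. Second proof file towards **crit-perc.S22**
(`Literature.Probability.RandomPlanarGeometry.isLocalMartingale_stoppedProcess_cardyObservable_iff`,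
`SLEMartingale`). This is the stochastic-calculus content of the statement — "the computation
(Cardy's formula computation for SLE in Greg Lawler's course)" of Werner (2007), §3 (pp. 19, 25–26
of arXiv:0710.0856), for three marks on one side of the driving point.

For the frozen real flows `Xⁱ = g(xᵢ) - W` (`dXⁱ = (2/Xⁱ) dt - √κ dB`) of marks `0 < x₀ < x₁ < x₂`,
Cardy's cross-ratio is `η = X⁰(X² - X¹)/(X¹(X² - X⁰))` (`cardyEta`, `SLECardyFlow`). Itô's formula
gives, for every `C²` function `h`,
`d h(η_t) = { η D₀₁ S/(X⁰X¹)² [ (κ/2) η(1-η) h''(η) + 2(1-2η) h'(η) ] + (6-κ) η D₀₁ X⁰/(X⁰X¹)² h'(η) } dt + dMₜ`,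
`D₀₁ = X¹ - X⁰`, `S = X¹(X² - X⁰)/X²`; for Cardy's hypergeometric function `F`
(`η(1-η)F'' = -(2/3)(1-2η)F'`, Cardy (1992), eq. (8)) the drift is
`𝓛_κ = (6-κ)/3 · F'(η) · η (X¹-X⁰)(X⁰X¹+X⁰X²+X¹X²)/((X⁰)²(X¹)²X²)` (`cardyDrift`), of the sign of
`6 - κ`. The main theorem `martingale_cardyObservable_sub_timeIntegral` states that, up to the level
stopping time `ρ = cardyLevelTime κ x m M d` of `SLECardyFlow`,
`t ↦ F(η_{t∧ρ}) - ∫₀ᵗ 𝟙_{s≤ρ} 𝓛_κ(X⁰_s, X¹_s, X²_s) ds` is a martingale of the raw Brownian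
filtration under the (pre-)Wiener measure, for every `κ > 0`.

Proof architecture (tree tools only): the stopped flow `V = (X⁰)^ρ` is an Itô process
(`isItoProcess_stoppedProcess_sleRealFlowStop`); `R = 1/V` by Itô's formula for a `C²`
modification of `v ↦ 1/v` off `[m/2, 2M]` (`ito_formula_itoProcess_of_progressive_holds`,
`exists_contDiff_eqOn_Icc`); the finite-variation processes `E = D₀₁D₀₂/D₁₂`, `q = D₀₁/D₁₂` are
time integrals (pathwise calculus); `P = R E + q = (1-η)/η` by the product rule
(`IsItoProcess.mul_timeIntegral`, `.add_const_mul_timeIntegral`); and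
`F(η) = G(P)`, `G(p) = F(1/(1+p))`, by `martingale_apply_sub_timeIntegral` for a `C²` modification
of `G`; the drift is identified by the algebraic identity `cardy_drift_identity`.

## References

* W. Werner, *Lectures on two-dimensional critical percolation*, IAS/Park City (2007),
  arXiv:0710.0856, §3 (pp. 19, 25–26).
* G. Lawler, O. Schramm, W. Werner, *Values of Brownian intersection exponents I*, Acta Math. 187
  (2001), §3 (proof of Thm. 3.2).
* G. F. Lawler, *Conformally Invariant Processes in the Plane*, AMS (2005), §6.7.
* J. L. Cardy, *Critical percolation in finite geometries*, J. Phys. A 25 (1992) L201, eq. (8).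
* D. Revuz, M. Yor, *Continuous Martingales and Brownian Motion* (1999), Ch. IV, Thm (3.3).
-/

noncomputable section

open MeasureTheory ProbabilityTheory Filter Set Topology
open scoped NNReal ENNReal

namespace Literature.Probability.RandomPlanarGeometry

open Loewner Literature.Probability.Process Literature.Analysis.FunctionSpaces
  Literature.Analysis.Calculus

/-! ### Calculus of Cardy's function: `F'`, `F''` and the hypergeometric equation -/

/-- **The derivative of Cardy's function in closed form**, `F'(η) = (cardyConst/3) (η(1-η))^{-2/3}`
(Cardy (1992), eq. (8)); meaningful for `η ∈ (0, 1)`. [cite: Cardy1992, eq. (8)] -/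
def cardyDerivF (η : ℝ) : ℝ :=
  cardyConst / 3 * (η * (1 - η)) ^ (-(2 / 3 : ℝ))

/-- Unfolding of `cardyDerivF`. [folklore] -/
theorem cardyDerivF_apply (η : ℝ) :
    cardyDerivF η = cardyConst / 3 * (η * (1 - η)) ^ (-(2 / 3 : ℝ)) := rfl

/-- `F' > 0` on `(0, 1)`. [cite: Cardy1992, eq. (8)] -/
theorem cardyDerivF_pos {η : ℝ} (hη : η ∈ Ioo (0 : ℝ) 1) : 0 < cardyDerivF η := by
  unfold cardyDerivF
  have h1 : 0 < η * (1 - η) := mul_pos hη.1 (by linarith [hη.2])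
  exact mul_pos (div_pos cardyConst_pos (by norm_num)) (Real.rpow_pos_of_pos h1 _)

/-- `F` has derivative `cardyDerivF η` at every `η ∈ (0, 1)` (`hasDerivAt_cardyFunction_holds`).
[cite: Cardy1992, eq. (8)] -/
theorem hasDerivAt_cardyFunction' {η : ℝ} (hη : η ∈ Ioo (0 : ℝ) 1) :
    HasDerivAt cardyFunction (cardyDerivF η) η :=
  hasDerivAt_cardyFunction_holds hη

/-- **The second derivative of Cardy's function**: on `(0, 1)`,
`(F')' = -(2/3) (1-2η)/(η(1-η)) · F'`, i.e. the hypergeometric equation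
`η(1-η)F'' + (2/3)(1-2η)F' = 0` of Cardy's `₂F₁(1/3, 2/3; 4/3; ·)` (differentiate the closed form
of `F'`). [cite: Cardy1992, eq. (8)] -/
theorem hasDerivAt_cardyDerivF {η : ℝ} (hη : η ∈ Ioo (0 : ℝ) 1) :
    HasDerivAt cardyDerivF (-(2 / 3) * (1 - 2 * η) / (η * (1 - η)) * cardyDerivF η) η := by
  have h1 : 0 < η * (1 - η) := mul_pos hη.1 (by linarith [hη.2])
  have hu : HasDerivAt (fun u : ℝ ↦ u * (1 - u)) (1 - 2 * η) η := by
    refine ((hasDerivAt_id' η).mul ((hasDerivAt_const η (1 : ℝ)).sub (hasDerivAt_id' η))).congr_deriv ?_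
    simp only [Pi.sub_apply]
    ring
  have hpow := hu.rpow_const (p := -(2 / 3 : ℝ)) (Or.inl h1.ne')
  have h := hpow.const_mul (cardyConst / 3)
  refine h.congr_deriv ?_
  rw [cardyDerivF_apply]
  have h2 : (η * (1 - η)) ^ (-(2 / 3 : ℝ) - 1) = (η * (1 - η)) ^ (-(2 / 3 : ℝ)) / (η * (1 - η)) := by
    rw [Real.rpow_sub_one h1.ne']
  rw [h2]
  field_simp

/-! ### Pathwise calculus: a product-quotient of truncated time integrals -/

/-- **Product-quotient of truncated time integrals** (pathwise calculus). Let `s ↦ Gᵢ(s, ω)`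
(`i = 1, 2, 3`) be continuous, `ρ` a random time, `Aᵢ(t) = cᵢ + ∫₀ᵗ 𝟙_{s ≤ ρ} Gᵢ ds`, with
`A₃ ≠ 0` at all times. Then
`A₁A₂/A₃ (t) = c₁c₂/c₃ + ∫₀ᵗ 𝟙_{s≤ρ} [ (G₁A₂ + A₁G₂)/A₃ - A₁A₂G₃/A₃² ] ds`: the fundamental theorem
of calculus on `[0, t ∧ ρ]` and constancy of both sides after `ρ`. This produces the
finite-variation factors `E = D₀₁D₀₂/D₁₂` and `q = D₀₁/D₁₂` of `P = (1-η)/η` from the gaps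
`Dᵢⱼ = (xⱼ - xᵢ) + ∫ (2/Xʲ - 2/Xⁱ) ds` of the real Loewner flow. [folklore] -/
theorem mul_div_eq_add_timeIntegral {Ω : Type*} {G₁ G₂ G₃ : ℝ≥0 → Ω → ℝ}
    {ρ : Ω → WithTop ℝ≥0} {c₁ c₂ c₃ : ℝ} {ω : Ω}
    (hG₁ : Continuous fun s ↦ G₁ s ω) (hG₂ : Continuous fun s ↦ G₂ s ω)
    (hG₃ : Continuous fun s ↦ G₃ s ω)
    (hne : ∀ t, c₃ + timeIntegral (trunc ρ G₃) t ω ≠ 0) (t : ℝ≥0) :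
    (c₁ + timeIntegral (trunc ρ G₁) t ω) * (c₂ + timeIntegral (trunc ρ G₂) t ω) /
        (c₃ + timeIntegral (trunc ρ G₃) t ω) =
      c₁ * c₂ / c₃ + timeIntegral (trunc ρ fun s ω ↦
        (G₁ s ω * (c₂ + timeIntegral (trunc ρ G₂) s ω) +
            (c₁ + timeIntegral (trunc ρ G₁) s ω) * G₂ s ω) /
          (c₃ + timeIntegral (trunc ρ G₃) s ω) -
        (c₁ + timeIntegral (trunc ρ G₁) s ω) * (c₂ + timeIntegral (trunc ρ G₂) s ω) * G₃ s ω /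
          (c₃ + timeIntegral (trunc ρ G₃) s ω) ^ 2) t ω := by
  have hc₃ : c₃ ≠ 0 := by simpa [timeIntegral] using hne 0
  -- the continuous paths and their primitives
  set g₁ : ℝ → ℝ := fun s ↦ G₁ s.toNNReal ω with hg₁def
  set g₂ : ℝ → ℝ := fun s ↦ G₂ s.toNNReal ω with hg₂def
  set g₃ : ℝ → ℝ := fun s ↦ G₃ s.toNNReal ω with hg₃def
  have hg₁ : Continuous g₁ := hG₁.comp continuous_real_toNNReal
  have hg₂ : Continuous g₂ := hG₂.comp continuous_real_toNNReal
  have hg₃ : Continuous g₃ := hG₃.comp continuous_real_toNNReal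
  set F₁ : ℝ → ℝ := fun s ↦ c₁ + ∫ r in (0 : ℝ)..s, g₁ r with hF₁def
  set F₂ : ℝ → ℝ := fun s ↦ c₂ + ∫ r in (0 : ℝ)..s, g₂ r with hF₂def
  set F₃ : ℝ → ℝ := fun s ↦ c₃ + ∫ r in (0 : ℝ)..s, g₃ r with hF₃def
  have hF₁d : ∀ s, HasDerivAt F₁ (g₁ s) s := fun s ↦
    ((hg₁.integral_hasStrictDerivAt 0 s).hasDerivAt).const_add c₁
  have hF₂d : ∀ s, HasDerivAt F₂ (g₂ s) s := fun s ↦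
    ((hg₂.integral_hasStrictDerivAt 0 s).hasDerivAt).const_add c₂
  have hF₃d : ∀ s, HasDerivAt F₃ (g₃ s) s := fun s ↦
    ((hg₃.integral_hasStrictDerivAt 0 s).hasDerivAt).const_add c₃
  have hF₁c : Continuous F₁ := continuous_iff_continuousAt.2 fun s ↦ (hF₁d s).continuousAt
  have hF₂c : Continuous F₂ := continuous_iff_continuousAt.2 fun s ↦ (hF₂d s).continuousAt
  have hF₃c : Continuous F₃ := continuous_iff_continuousAt.2 fun s ↦ (hF₃d s).continuousAt
  -- on `[0, T]` with `↑T ≤ ρ ω` the truncated integrals are the primitives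
  have hFT : ∀ (T : ℝ≥0), (T : WithTop ℝ≥0) ≤ ρ ω → ∀ (G : ℝ≥0 → Ω → ℝ) (c : ℝ),
      ∀ s ∈ Icc (0 : ℝ) T, c + timeIntegral (trunc ρ G) s.toNNReal ω =
        c + ∫ r in (0 : ℝ)..s, G r.toNNReal ω := by
    intro T hT G c s hs
    simp only [timeIntegral, Real.coe_toNNReal _ hs.1]
    congr 1
    refine intervalIntegral.integral_congr fun r hr ↦ ?_
    rw [uIcc_of_le hs.1] at hr
    exact trunc_toNNReal_eq_of_le hT ⟨hr.1, hr.2.trans hs.2⟩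
  -- Step 1: the identity up to a time `T` with `↑T ≤ ρ ω`
  have step : ∀ T : ℝ≥0, (T : WithTop ℝ≥0) ≤ ρ ω →
      (c₁ + timeIntegral (trunc ρ G₁) T ω) * (c₂ + timeIntegral (trunc ρ G₂) T ω) /
        (c₃ + timeIntegral (trunc ρ G₃) T ω) =
      c₁ * c₂ / c₃ + timeIntegral (trunc ρ fun s ω ↦
        (G₁ s ω * (c₂ + timeIntegral (trunc ρ G₂) s ω) +
            (c₁ + timeIntegral (trunc ρ G₁) s ω) * G₂ s ω) /
          (c₃ + timeIntegral (trunc ρ G₃) s ω) -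
        (c₁ + timeIntegral (trunc ρ G₁) s ω) * (c₂ + timeIntegral (trunc ρ G₂) s ω) * G₃ s ω /
          (c₃ + timeIntegral (trunc ρ G₃) s ω) ^ 2) T ω := by
    intro T hT
    have h₁ : ∀ s ∈ Icc (0 : ℝ) T, c₁ + timeIntegral (trunc ρ G₁) s.toNNReal ω = F₁ s :=
      hFT T hT G₁ c₁
    have h₂ : ∀ s ∈ Icc (0 : ℝ) T, c₂ + timeIntegral (trunc ρ G₂) s.toNNReal ω = F₂ s :=
      hFT T hT G₂ c₂
    have h₃ : ∀ s ∈ Icc (0 : ℝ) T, c₃ + timeIntegral (trunc ρ G₃) s.toNNReal ω = F₃ s :=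
      hFT T hT G₃ c₃
    have hF₃ne : ∀ s ∈ Icc (0 : ℝ) T, F₃ s ≠ 0 := fun s hs ↦ by rw [← h₃ s hs]; exact hne _
    -- FTC for `F₁F₂/F₃` on `[0, T]`
    set φ : ℝ → ℝ := fun s ↦ (g₁ s * F₂ s + F₁ s * g₂ s) / F₃ s -
      F₁ s * F₂ s * g₃ s / F₃ s ^ 2 with hφdef
    have hderiv : ∀ s ∈ Ioo (0 : ℝ) T, HasDerivAt (fun s ↦ F₁ s * F₂ s / F₃ s) (φ s) s := by
      intro s hs
      have hne' := hF₃ne s ⟨hs.1.le, hs.2.le⟩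
      refine (((hF₁d s).mul (hF₂d s)).div (hF₃d s) hne').congr_deriv ?_
      simp only [hφdef, Pi.mul_apply]
      field_simp
    have hcont : ContinuousOn (fun s ↦ F₁ s * F₂ s / F₃ s) (Icc 0 T) :=
      (hF₁c.continuousOn.mul hF₂c.continuousOn).div hF₃c.continuousOn hF₃ne
    have hcont' : ContinuousOn φ (Icc 0 T) := by
      refine ContinuousOn.sub ?_ ?_
      · exact ((hg₁.continuousOn.mul hF₂c.continuousOn).add
          (hF₁c.continuousOn.mul hg₂.continuousOn)).div hF₃c.continuousOn hF₃ne
      · exact ((hF₁c.continuousOn.mul hF₂c.continuousOn).mul hg₃.continuousOn).div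
          (hF₃c.continuousOn.pow 2) fun s hs ↦ pow_ne_zero 2 (hF₃ne s hs)
    have hFTC := intervalIntegral.integral_eq_sub_of_hasDerivAt_of_le T.coe_nonneg hcont hderiv
      (hcont'.intervalIntegrable_of_Icc T.coe_nonneg)
    -- rewrite both sides
    have hT' : (T : ℝ) ∈ Icc (0 : ℝ) T := ⟨T.coe_nonneg, le_rfl⟩
    have hL₁ : c₁ + timeIntegral (trunc ρ G₁) T ω = F₁ T := by
      have := h₁ T hT'; rwa [Real.toNNReal_coe] at this
    have hL₂ : c₂ + timeIntegral (trunc ρ G₂) T ω = F₂ T := by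
      have := h₂ T hT'; rwa [Real.toNNReal_coe] at this
    have hL₃ : c₃ + timeIntegral (trunc ρ G₃) T ω = F₃ T := by
      have := h₃ T hT'; rwa [Real.toNNReal_coe] at this
    have hR : timeIntegral (trunc ρ fun s ω ↦
        (G₁ s ω * (c₂ + timeIntegral (trunc ρ G₂) s ω) +
            (c₁ + timeIntegral (trunc ρ G₁) s ω) * G₂ s ω) /
          (c₃ + timeIntegral (trunc ρ G₃) s ω) -
        (c₁ + timeIntegral (trunc ρ G₁) s ω) * (c₂ + timeIntegral (trunc ρ G₂) s ω) * G₃ s ω /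
          (c₃ + timeIntegral (trunc ρ G₃) s ω) ^ 2) T ω = ∫ s in (0 : ℝ)..T, φ s := by
      simp only [timeIntegral]
      refine intervalIntegral.integral_congr fun s hs ↦ ?_
      rw [uIcc_of_le T.coe_nonneg] at hs
      have e₁ := h₁ s hs
      have e₂ := h₂ s hs
      have e₃ := h₃ s hs
      simp only [timeIntegral] at e₁ e₂ e₃
      rw [trunc_toNNReal_eq_of_le hT hs, e₁, e₂, e₃]
    have h0₁ : F₁ 0 = c₁ := by simp [hF₁def]
    have h0₂ : F₂ 0 = c₂ := by simp [hF₂def]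
    have h0₃ : F₃ 0 = c₃ := by simp [hF₃def]
    rw [hL₁, hL₂, hL₃, hR, hFTC, h0₁, h0₂, h0₃]
    ring
  -- Step 2: the general case
  by_cases ht : (t : WithTop ℝ≥0) ≤ ρ ω
  · exact step t ht
  · rw [not_le] at ht
    obtain ⟨r₀, hr₀⟩ := WithTop.ne_top_iff_exists.1 ht.ne_top
    have hr₀t : r₀ < t := by rw [← hr₀] at ht; exact WithTop.coe_lt_coe.1 ht
    have hr₀le : (r₀ : WithTop ℝ≥0) ≤ ρ ω := by rw [hr₀]
    have hstep := step r₀ hr₀le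
    have hconst : ∀ (H : ℝ≥0 → Ω → ℝ),
        timeIntegral (trunc ρ H) t ω = timeIntegral (trunc ρ H) r₀ ω := by
      intro H
      rw [timeIntegral_trunc, timeIntegral_trunc, ← hr₀, min_self,
        min_eq_right (WithTop.coe_le_coe.2 hr₀t.le)]
    rw [hconst, hconst, hconst, hconst]
    exact hstep

/-- Derivative of `v ↦ -(v²)⁻¹`: `2 (v³)⁻¹` (`v ≠ 0`). [folklore] -/
theorem hasDerivAt_neg_inv_sq {v : ℝ} (hv : v ≠ 0) :
    HasDerivAt (fun u : ℝ ↦ -(u ^ 2)⁻¹) (2 * (v ^ 3)⁻¹) v := by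
  have h := ((hasDerivAt_pow 2 v).inv (pow_ne_zero 2 hv)).neg
  refine h.congr_deriv ?_
  field_simp
  ring

/-! ### The Itô drift of Cardy's observable -/

/-- **The Itô drift of `F(η)` along the three-point flow**:
`𝓛_κ(a, b, c) = (6-κ)/3 · F'(η) · η (b-a)(ab+ac+bc)/(a²b²c)`, `η = cardyEta a b c`, for the flows
`a = X⁰`, `b = X¹`, `c = X²` (positive multiple of `6 - κ` when `0 < a < b < c`).
[cite: Werner2007, §3] -/
def cardyDrift (κ : ℝ≥0) (a b c : ℝ) : ℝ :=
  (6 - (κ : ℝ)) / 3 * cardyDerivF (cardyEta a b c) *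
    (cardyEta a b c * (b - a) * (a * b + a * c + b * c) / (a ^ 2 * b ^ 2 * c))

/-- Unfolding of `cardyDrift`. [folklore] -/
theorem cardyDrift_apply (κ : ℝ≥0) (a b c : ℝ) :
    cardyDrift κ a b c = (6 - (κ : ℝ)) / 3 * cardyDerivF (cardyEta a b c) *
      (cardyEta a b c * (b - a) * (a * b + a * c + b * c) / (a ^ 2 * b ^ 2 * c)) := rfl

/-- The geometric factor of the drift is positive for `0 < a < b < c`. [folklore] -/
theorem cardyDrift_factor_pos {a b c : ℝ} (ha : 0 < a) (hab : a < b) (hbc : b < c) :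
    0 < cardyDerivF (cardyEta a b c) *
      (cardyEta a b c * (b - a) * (a * b + a * c + b * c) / (a ^ 2 * b ^ 2 * c)) := by
  have hη := cardyEta_mem_Ioo ha hab hbc
  have hb : 0 < b := ha.trans hab
  have hc : 0 < c := hb.trans hbc
  refine mul_pos (cardyDerivF_pos hη) (div_pos ?_ (by positivity))
  exact mul_pos (mul_pos hη.1 (by linarith)) (by positivity)

/-- At `κ = 6` the drift vanishes identically. [cite: Werner2007, §3] -/
theorem cardyDrift_six (a b c : ℝ) : cardyDrift 6 a b c = 0 := by
  simp [cardyDrift]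

/-- **The drift identity** (the "homework exercise" of Werner (2007), §3, p. 26, in the
three-marks-on-one-side configuration). With `a = X⁰`, `b = X¹`, `c = X²`, `R = 1/a`,
`E = D₀₁D₀₂/D₁₂`, `q = D₀₁/D₁₂`, `P = R E + q = (1-η)/η`, the Itô coefficients
`b_P = R Ė + E b_R + q̇`, `σ_P = (√κ/a²) E` of `P` (`b_R = (κ-2)/a³`) and the derivatives
`G' = -F'(η) η²`, `G'' = F''(η) η⁴ + 2F'(η) η³` of `G(p) = F(1/(1+p))`, where
`F'' = -(2/3)(1-2η)/(η(1-η)) F'`, one has `b_P G' + ½ σ_P² G'' = 𝓛_κ(a, b, c)` (the left-hand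
side is written exactly as it comes out of the product rule and Itô's formula in
`martingale_cardyObservable_sub_timeIntegral`). [cite: Werner2007, §3] -/
theorem cardy_drift_identity (κ : ℝ≥0) {a b c : ℝ} (ha : a ≠ 0) (hb : b ≠ 0) (hc : c ≠ 0)
    (hba : b - a ≠ 0) (hcb : c - b ≠ 0) (hca : c - a ≠ 0) :
    (a⁻¹ * (((2 / b - 2 / a) * (c - a) + (b - a) * (2 / b - 2 / a + (2 / c - 2 / b))) / (c - b) -
      (b - a) * (c - a) * (2 / c - 2 / b) / (c - b) ^ 2) + (b - a) * (c - a) / (c - b) * (2 / a *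
      -(a ^ 2)⁻¹ + 2⁻¹ * (-Real.sqrt κ) ^ 2 * (2 * (a ^ 3)⁻¹)) + 1 * (((2 / b - 2 / a) * 1 + (b -
      a) * 0) / (c - b) - (b - a) * 1 * (2 / c - 2 / b) / (c - b) ^ 2)) * -(cardyDerivF (cardyEta
      (a) (b) (c)) * cardyEta (a) (b) (c) ^ 2) + 2⁻¹ * (-Real.sqrt κ * -(a ^ 2)⁻¹ * ((b - a) * (c
      - a) / (c - b))) ^ 2 * (-(2 / 3) * (1 - 2 * cardyEta (a) (b) (c)) / (cardyEta (a) (b) (c) *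
      (1 - cardyEta (a) (b) (c))) * cardyDerivF (cardyEta (a) (b) (c)) * cardyEta (a) (b) (c) ^ 4
      + 2 * cardyDerivF (cardyEta (a) (b) (c)) * cardyEta (a) (b) (c) ^ 3) =
      cardyDrift κ (a) (b) (c) := by
  set Fη := cardyDerivF (cardyEta a b c) with hF
  have h2η : 1 - 2 * cardyEta a b c = (1 - cardyEta a b c) - cardyEta a b c := by ring
  rw [cardyDrift_apply, ← hF, h2η, one_sub_cardyEta hb hca]
  simp only [cardyEta]
  have hsq : Real.sqrt κ ^ 2 = κ := Real.sq_sqrt κ.coe_nonneg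
  simp only [mul_pow, neg_sq, hsq]
  field_simp
  ring

/-! ### The stopped observable minus its drift is a martingale (fixed levels) -/

section Main

variable {κ : ℝ≥0} {x : Fin 3 → ℝ} {m M d : ℝ}

/-- `G(p) = F(1/(1+p))` is `C²` on `(0, ∞)` (Cardy's `F` is analytic on `(0, 1)`). [folklore] -/
theorem contDiffOn_cardyFunction_comp_inv :
    ContDiffOn ℝ 2 (fun p : ℝ ↦ cardyFunction (1 + p)⁻¹) (Ioi 0) := by
  have hF : ContDiffOn ℝ 2 cardyFunction (Ioo 0 1) :=
    analyticOnNhd_cardyFunction_Ioo.contDiffOn_of_completeSpace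
  have hμ : ContDiffOn ℝ 2 (fun p : ℝ ↦ (1 + p)⁻¹) (Ioi 0) :=
    (contDiffOn_const.add contDiffOn_id).inv fun p hp ↦ by
      have : (0 : ℝ) < 1 + p := by linarith [mem_Ioi.1 hp]
      exact this.ne'
  refine hF.comp hμ fun p hp ↦ ?_
  have hp' : (0 : ℝ) < p := hp
  have h1 : (0 : ℝ) < 1 + p := by linarith
  refine ⟨inv_pos.2 h1, ?_⟩
  rw [inv_lt_one_iff₀]
  exact Or.inr (by linarith)

/-- Derivatives of `G(p) = F(1/(1+p))` at `p > 0`: with `η = (1+p)⁻¹`,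
`G'(p) = -(F'(η) η²)` and `(G')'(p) = (-(2/3)(1-2η)/(η(1-η)) F'(η)) η⁴ + 2 F'(η) η³`.
[cite: Cardy1992, eq. (8)] -/
theorem hasDerivAt_cardyFunction_comp_inv {p : ℝ} (hp : 0 < p) :
    HasDerivAt (fun p : ℝ ↦ cardyFunction (1 + p)⁻¹)
      (-(cardyDerivF (1 + p)⁻¹ * ((1 + p)⁻¹) ^ 2)) p ∧
    HasDerivAt (fun p : ℝ ↦ -(cardyDerivF (1 + p)⁻¹ * ((1 + p)⁻¹) ^ 2))
      ((-(2 / 3) * (1 - 2 * (1 + p)⁻¹) / ((1 + p)⁻¹ * (1 - (1 + p)⁻¹)) * cardyDerivF (1 + p)⁻¹) *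
          ((1 + p)⁻¹) ^ 4 + 2 * cardyDerivF (1 + p)⁻¹ * ((1 + p)⁻¹) ^ 3) p := by
  have h1 : (0 : ℝ) < 1 + p := by linarith
  have hη : (1 + p)⁻¹ ∈ Ioo (0 : ℝ) 1 := by
    refine ⟨inv_pos.2 h1, ?_⟩
    rw [inv_lt_one_iff₀]
    exact Or.inr (by linarith)
  -- the inner map `μ(p) = (1+p)⁻¹`, `μ' = -μ²`
  have hμ : HasDerivAt (fun q : ℝ ↦ (1 + q)⁻¹) (-((1 + p)⁻¹) ^ 2) p := by
    have h := ((hasDerivAt_id' p).const_add 1).inv h1.ne'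
    refine h.congr_deriv ?_
    field_simp
  have hG1 : HasDerivAt (fun p : ℝ ↦ cardyFunction (1 + p)⁻¹)
      (-(cardyDerivF (1 + p)⁻¹ * ((1 + p)⁻¹) ^ 2)) p := by
    have h := (hasDerivAt_cardyFunction' hη).comp p hμ
    refine h.congr_deriv ?_
    ring
  refine ⟨hG1, ?_⟩
  -- second derivative: product of `F' ∘ μ` and `-μ²`
  have hA := (hasDerivAt_cardyDerivF hη).comp p hμ
  have hB : HasDerivAt (fun q : ℝ ↦ ((1 + q)⁻¹) ^ 2) (2 * (1 + p)⁻¹ * (-((1 + p)⁻¹) ^ 2)) p := by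
    have h := hμ.pow 2
    refine h.congr_deriv ?_
    simp
  have h := (hA.mul hB).neg
  refine h.congr_deriv ?_
  simp only [Function.comp_apply]
  ring

variable (hκ : 0 < κ) (hx : StrictMono x) (hx0 : 0 < x 0) (hm : 0 < m) (hmx : m < x 0)
  (hxM : x 0 < M) (hd : 0 < d) (hd₁ : d < x 1 - x 0) (hd₂ : d < x 2 - x 1)
include hx hx0 hm hmx hxM hd hd₁ hd₂

/-- **Bounds along the stopped three-point flow** (every path and time): with
`ρ = cardyLevelTime κ x m M d` and `Vⁱ = (Xⁱ)^ρ`, `m ≤ V⁰ ≤ M`, `d ≤ V¹ - V⁰ ≤ x₁ - x₀`,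
`d ≤ V² - V¹ ≤ x₂ - x₁`, `0 < V⁰ < V¹ < V²`. [cite: Werner2007, §3] -/
theorem cardyLevel_stopped_bounds (ω : ℝ≥0 → ℝ) (t : ℝ≥0) :
    stoppedProcess (sleRealFlowStop κ (x 0)) (cardyLevelTime κ x m M d) t ω ∈ Icc m M ∧
      stoppedProcess (sleRealFlowStop κ (x 1)) (cardyLevelTime κ x m M d) t ω -
          stoppedProcess (sleRealFlowStop κ (x 0)) (cardyLevelTime κ x m M d) t ω ∈ Icc d (x 1 - x 0) ∧
      stoppedProcess (sleRealFlowStop κ (x 2)) (cardyLevelTime κ x m M d) t ω -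
          stoppedProcess (sleRealFlowStop κ (x 1)) (cardyLevelTime κ x m M d) t ω ∈ Icc d (x 2 - x 1) ∧
      0 < stoppedProcess (sleRealFlowStop κ (x 0)) (cardyLevelTime κ x m M d) t ω ∧
      stoppedProcess (sleRealFlowStop κ (x 0)) (cardyLevelTime κ x m M d) t ω <
        stoppedProcess (sleRealFlowStop κ (x 1)) (cardyLevelTime κ x m M d) t ω ∧
      stoppedProcess (sleRealFlowStop κ (x 1)) (cardyLevelTime κ x m M d) t ω <
        stoppedProcess (sleRealFlowStop κ (x 2)) (cardyLevelTime κ x m M d) t ω := by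
  have h := cardyLevel_bounds_of_le (κ := κ) hx hx0 hm hmx hxM hd hd₁ hd₂
    (coe_untopA_min_le t (cardyLevelTime κ x m M d ω))
  exact ⟨h.2.1, h.2.2.1, h.2.2.2.1, h.2.2.2.2.1, h.2.2.2.2.2.1, h.2.2.2.2.2.2⟩

set_option maxHeartbeats 1600000 in
include hκ in
/-- **Itô's formula for Cardy's observable with the drift kept.** Let `κ > 0`, marks
`0 < x₀ < x₁ < x₂`, levels `0 < m < x₀ < M`, `0 < d < min(x₁ - x₀, x₂ - x₁)`, `ρ` the level
stopping time (`cardyLevelTime`) and `Xⁱ` the frozen real flows of the marks. Then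
`t ↦ F(η(X⁰, X¹, X²)_{t∧ρ}) - ∫₀ᵗ 𝟙_{s≤ρ} 𝓛_κ(X⁰_s, X¹_s, X²_s) ds` is a martingale of the raw
Brownian filtration under the (pre-)Wiener measure, where `F` is Cardy's function, `η = cardyEta`
Cardy's cross-ratio and `𝓛_κ = cardyDrift κ` its Itô drift (a positive multiple of `6 - κ`). This
is Itô's formula for `F(η_t)` along `dXⁱ = (2/Xⁱ)dt - √κ dB` — "the computation … in Greg
Lawler's course" of Werner (2007), §3, pp. 19 and 25–26 — made rigorous with the tree's Itô
formula for Itô processes and product rule. [cite: Werner2007, §3] -/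
theorem martingale_cardyObservable_sub_timeIntegral :
    Martingale (fun t ω ↦ cardyFunction (cardyEta
        (stoppedProcess (sleRealFlowStop κ (x 0)) (cardyLevelTime κ x m M d) t ω)
        (stoppedProcess (sleRealFlowStop κ (x 1)) (cardyLevelTime κ x m M d) t ω)
        (stoppedProcess (sleRealFlowStop κ (x 2)) (cardyLevelTime κ x m M d) t ω)) -
      timeIntegral (trunc (cardyLevelTime κ x m M d) fun s ω ↦
        cardyDrift κ (sleRealFlowStop κ (x 0) s ω) (sleRealFlowStop κ (x 1) s ω)
          (sleRealFlowStop κ (x 2) s ω)) t ω)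
      brownianFiltration preWienerMeasure := by
  haveI := isProbabilityMeasure_preWienerMeasure'
  have hx1 : 0 < x 1 := marks_pos hx hx0 1
  have hx2 : 0 < x 2 := marks_pos hx hx0 2
  have h01 : x 0 < x 1 := marks_zero_lt_one hx
  have h12 : x 1 < x 2 := marks_one_lt_two hx
  have hκ0 : (0 : ℝ) < κ := by exact_mod_cast hκ
  set ρ := cardyLevelTime κ x m M d with hρdef
  have hρ : IsStoppingTime brownianFiltration ρ := isStoppingTime_cardyLevelTime hx hx0 m M d
  have hρ' : ∀ t : ℝ≥0, MeasurableSet[brownianFiltration t] {ω | ρ ω < t} :=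
    fun t ↦ hρ.measurableSet_lt t
  -- the three frozen flows and their stopped versions
  set X₀ := sleRealFlowStop κ (x 0) with hX₀def
  set X₁ := sleRealFlowStop κ (x 1) with hX₁def
  set X₂ := sleRealFlowStop κ (x 2) with hX₂def
  have hX₀c : ∀ ω, Continuous fun t ↦ X₀ t ω := continuous_sleRealFlowStop hx0.ne'
  have hX₁c : ∀ ω, Continuous fun t ↦ X₁ t ω := continuous_sleRealFlowStop hx1.ne'
  have hX₂c : ∀ ω, Continuous fun t ↦ X₂ t ω := continuous_sleRealFlowStop hx2.ne'
  have hX₀prog := isStronglyProgressive_sleRealFlowStop κ hx0.ne'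
  have hX₁prog := isStronglyProgressive_sleRealFlowStop κ hx1.ne'
  have hX₂prog := isStronglyProgressive_sleRealFlowStop κ hx2.ne'
  set V := stoppedProcess X₀ ρ with hVdef
  set V₁ := stoppedProcess X₁ ρ with hV₁def
  set V₂ := stoppedProcess X₂ ρ with hV₂def
  have hB : ∀ ω t, V t ω ∈ Icc m M ∧ V₁ t ω - V t ω ∈ Icc d (x 1 - x 0) ∧
      V₂ t ω - V₁ t ω ∈ Icc d (x 2 - x 1) ∧ 0 < V t ω ∧ V t ω < V₁ t ω ∧ V₁ t ω < V₂ t ω :=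
    fun ω t ↦ cardyLevel_stopped_bounds (κ := κ) hx hx0 hm hmx hxM hd hd₁ hd₂ ω t
  have hρX : ∀ ω (t : ℝ≥0), (t : WithTop ℝ≥0) ≤ ρ ω → X₀ t ω ≠ 0 := fun ω t ht ↦ by
    have h := (cardyLevel_bounds_of_le (κ := κ) hx hx0 hm hmx hxM hd hd₁ hd₂ ht).2.1
    exact (hm.trans_le h.1).ne'
  set σ' : ℝ≥0 → (ℝ≥0 → ℝ) → ℝ := trunc ρ fun _ _ ↦ -Real.sqrt κ with hσ'def
  have hV : IsItoProcess V (trunc ρ fun s ω ↦ 2 / V s ω) σ' brownian brownianFiltration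
      preWienerMeasure := isItoProcess_stoppedProcess_sleRealFlowStop hx0.ne' hρ hρX
  have hVa : StronglyAdapted brownianFiltration V := hX₀prog.stronglyAdapted_stoppedProcess hρ
  have hV₁a : StronglyAdapted brownianFiltration V₁ := hX₁prog.stronglyAdapted_stoppedProcess hρ
  have hV₂a : StronglyAdapted brownianFiltration V₂ := hX₂prog.stronglyAdapted_stoppedProcess hρ
  have hVc : ∀ ω, Continuous (V · ω) := fun ω ↦ continuous_stoppedProcess_path (hX₀c ω) ρ
  have hV₁c : ∀ ω, Continuous (V₁ · ω) := fun ω ↦ continuous_stoppedProcess_path (hX₁c ω) ρ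
  have hV₂c : ∀ ω, Continuous (V₂ · ω) := fun ω ↦ continuous_stoppedProcess_path (hX₂c ω) ρ
  have hVprog : IsStronglyProgressive brownianFiltration V := hVa.isStronglyProgressive_of_continuous hVc
  have hV₁prog : IsStronglyProgressive brownianFiltration V₁ :=
    hV₁a.isStronglyProgressive_of_continuous hV₁c
  have hV₂prog : IsStronglyProgressive brownianFiltration V₂ :=
    hV₂a.isStronglyProgressive_of_continuous hV₂c
  have hσ' : IsStronglyProgressive brownianFiltration σ' :=
    isStronglyProgressive_trunc (isStronglyProgressive_const _ _) hρ'
  have hσ'bd : ∀ t ω, |σ' t ω| ≤ Real.sqrt κ := abs_trunc_neg_sqrt_le κ ρ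
  have hclock : ∀ ω (t : ℝ≥0), ((min (t : WithTop ℝ≥0) (ρ ω)).untopA : WithTop ℝ≥0) ≤ ρ ω :=
    fun ω t ↦ coe_untopA_min_le t (ρ ω)
  -- the gaps in integrated form
  set G₀₁ : ℝ≥0 → (ℝ≥0 → ℝ) → ℝ := fun s ω ↦ 2 / V₁ s ω - 2 / V s ω with hG₀₁def
  set G₁₂ : ℝ≥0 → (ℝ≥0 → ℝ) → ℝ := fun s ω ↦ 2 / V₂ s ω - 2 / V₁ s ω with hG₁₂def
  set G₀₂ : ℝ≥0 → (ℝ≥0 → ℝ) → ℝ := fun s ω ↦ G₀₁ s ω + G₁₂ s ω with hG₀₂def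
  have hgap : ∀ ω t, V₁ t ω - V t ω = (x 1 - x 0) + timeIntegral (trunc ρ G₀₁) t ω ∧
      V₂ t ω - V₁ t ω = (x 2 - x 1) + timeIntegral (trunc ρ G₁₂) t ω := by
    intro ω t
    set u : ℝ≥0 := (min (t : WithTop ℝ≥0) (ρ ω)).untopA with hu
    have hT := (cardyLevel_bounds_of_le (κ := κ) hx hx0 hm hmx hxM hd hd₁ hd₂ (hclock ω t)).1
    rw [swallowingStoppingTime_eq_holds hx hx0 ω] at hT
    obtain ⟨-, -, -, h1, h2⟩ := sleRealFlowStop_three_facts (κ := κ) hx hx0 hT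
    have key : ∀ (H : ℝ≥0 → (ℝ≥0 → ℝ) → ℝ) (Y Z : ℝ≥0 → (ℝ≥0 → ℝ) → ℝ),
        (∀ s, H s ω = 2 / stoppedProcess Y ρ s ω - 2 / stoppedProcess Z ρ s ω) →
        (∫ s in (0 : ℝ)..u, (2 / Y s.toNNReal ω - 2 / Z s.toNNReal ω)) =
          timeIntegral (trunc ρ H) t ω := by
      intro H Y Z hH
      rw [timeIntegral_trunc]
      change _ = ∫ s in (0 : ℝ)..u, H s.toNNReal ω
      refine intervalIntegral.integral_congr fun s hs ↦ ?_
      rw [uIcc_of_le u.coe_nonneg] at hs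
      have hsρ : (s.toNNReal : WithTop ℝ≥0) ≤ ρ ω :=
        (WithTop.coe_le_coe.2 (Real.toNNReal_le_iff_le_coe.2 hs.2)).trans (hclock ω t)
      simp only [hH, stoppedProcess_eq_of_le hsρ]
    constructor
    · change X₁ u ω - X₀ u ω = _
      rw [h1, key G₀₁ X₁ X₀ fun s ↦ rfl]
    · change X₂ u ω - X₁ u ω = _
      rw [h2, key G₁₂ X₂ X₁ fun s ↦ rfl]
  have hgap₀₂ : ∀ ω t, V₂ t ω - V t ω = (x 2 - x 0) + timeIntegral (trunc ρ G₀₂) t ω := by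
    intro ω t
    obtain ⟨h1, h2⟩ := hgap ω t
    have hint : ∀ (H : ℝ≥0 → (ℝ≥0 → ℝ) → ℝ), Continuous (fun s ↦ H s ω) →
        IntervalIntegrable (fun s : ℝ ↦ trunc ρ H s.toNNReal ω) volume 0 t := fun H hH ↦
      (intervalIntegrable_iff_integrableOn_Icc_of_le t.coe_nonneg).2
        (integrableOn_trunc ((hH.comp continuous_real_toNNReal).continuousOn.integrableOn_compact
          isCompact_Icc))
    have hc₀₁ : Continuous fun s ↦ G₀₁ s ω :=
      (continuous_const.div (hV₁c ω) fun s ↦ ((hB ω s).2.2.2.1.trans (hB ω s).2.2.2.2.1).ne').sub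
        (continuous_const.div (hVc ω) fun s ↦ (hB ω s).2.2.2.1.ne')
    have hc₁₂ : Continuous fun s ↦ G₁₂ s ω :=
      (continuous_const.div (hV₂c ω) fun s ↦
          (((hB ω s).2.2.2.1.trans (hB ω s).2.2.2.2.1).trans (hB ω s).2.2.2.2.2).ne').sub
        (continuous_const.div (hV₁c ω) fun s ↦ ((hB ω s).2.2.2.1.trans (hB ω s).2.2.2.2.1).ne')
    have hsum : timeIntegral (trunc ρ G₀₂) t ω =
        timeIntegral (trunc ρ G₀₁) t ω + timeIntegral (trunc ρ G₁₂) t ω := by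
      simp only [timeIntegral]
      rw [← intervalIntegral.integral_add (hint G₀₁ hc₀₁) (hint G₁₂ hc₁₂)]
      refine intervalIntegral.integral_congr fun s _ ↦ ?_
      simp only [trunc_apply, hG₀₂def]
      split_ifs <;> simp
    rw [hsum]
    linarith
  -- continuity of the gap rates
  have hG₀₁c : ∀ ω, Continuous fun s ↦ G₀₁ s ω := fun ω ↦
    (continuous_const.div (hV₁c ω) fun s ↦ ((hB ω s).2.2.2.1.trans (hB ω s).2.2.2.2.1).ne').sub
      (continuous_const.div (hVc ω) fun s ↦ (hB ω s).2.2.2.1.ne')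
  have hG₁₂c : ∀ ω, Continuous fun s ↦ G₁₂ s ω := fun ω ↦
    (continuous_const.div (hV₂c ω) fun s ↦
        (((hB ω s).2.2.2.1.trans (hB ω s).2.2.2.2.1).trans (hB ω s).2.2.2.2.2).ne').sub
      (continuous_const.div (hV₁c ω) fun s ↦ ((hB ω s).2.2.2.1.trans (hB ω s).2.2.2.2.1).ne')
  have hG₀₂c : ∀ ω, Continuous fun s ↦ G₀₂ s ω := fun ω ↦ (hG₀₁c ω).add (hG₁₂c ω)
  /- Step 1: `R = 1/V` is an Itô process (Itô's formula for a `C²` modification of `v ↦ 1/v`). -/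
  obtain ⟨g, hg, hgeq, -⟩ := exists_contDiff_eqOn_Icc (n := 2) (a := m / 4) (b := 2 * M + 1)
    (lo := m / 2) (hi := 2 * M) (by linarith) (by linarith) (by linarith)
    ((contDiffOn_inv ℝ).mono fun v hv ↦ by
      simp only [mem_compl_iff, mem_singleton_iff]
      exact (lt_trans (by linarith) hv.1).ne')
  have hgnhds : ∀ v ∈ Icc m M, g =ᶠ[𝓝 v] fun u ↦ u⁻¹ := by
    intro v hv
    have hmem : Ioo (m / 2) (2 * M) ∈ 𝓝 v := Ioo_mem_nhds (by linarith [hv.1]) (by linarith [hv.2])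
    filter_upwards [hmem] with u hu
    exact hgeq (Ioo_subset_Icc_self hu)
  have hg0 : ∀ v ∈ Icc m M, g v = v⁻¹ := fun v hv ↦
    hgeq ⟨by linarith [hv.1], by linarith [hv.2]⟩
  have hg1 : ∀ v ∈ Icc m M, deriv g v = -(v ^ 2)⁻¹ := by
    intro v hv
    rw [(hgnhds v hv).deriv_eq]
    exact deriv_inv
  have hg2 : ∀ v ∈ Icc m M, iteratedDeriv 2 g v = 2 * (v ^ 3)⁻¹ := by
    intro v hv
    have hv0 : v ≠ 0 := (hm.trans_le hv.1).ne'
    rw [iteratedDeriv_succ, iteratedDeriv_one]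
    have h1 : deriv g =ᶠ[𝓝 v] fun u ↦ -(u ^ 2)⁻¹ := by
      filter_upwards [(hgnhds v hv).deriv] with u hu
      rw [hu]
      exact deriv_inv
    rw [h1.deriv_eq]
    exact (hasDerivAt_neg_inv_sq hv0).deriv
  have hItoR := ito_formula_itoProcess_of_progressive_holds (fun (_ : ℝ) (v : ℝ) ↦ g v)
    (hg.comp contDiff_snd) (fun t ↦ (hVa t).measurable) hσ' hV
  set R : ℝ≥0 → (ℝ≥0 → ℝ) → ℝ := fun t ω ↦ (V t ω)⁻¹ with hRdef
  set bR : ℝ≥0 → (ℝ≥0 → ℝ) → ℝ := fun t ω ↦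
    trunc ρ (fun s ω ↦ 2 / V s ω) t ω * (-(V t ω ^ 2)⁻¹) +
      2⁻¹ * σ' t ω ^ 2 * (2 * (V t ω ^ 3)⁻¹) with hbRdef
  set σR : ℝ≥0 → (ℝ≥0 → ℝ) → ℝ := fun t ω ↦ σ' t ω * (-(V t ω ^ 2)⁻¹) with hσRdef
  have hR : IsItoProcess R bR σR brownian brownianFiltration preWienerMeasure := by
    have e1 : (fun (t : ℝ≥0) ω ↦ g (V t ω)) = R := by
      funext t ω; exact hg0 _ (hB ω t).1
    have e2 : (fun (t : ℝ≥0) ω ↦ deriv (fun (_ : ℝ) ↦ g (V t ω)) (t : ℝ) +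
        trunc ρ (fun s ω ↦ 2 / V s ω) t ω * deriv (fun v ↦ g v) (V t ω) +
        2⁻¹ * σ' t ω ^ 2 * iteratedDeriv 2 (fun v ↦ g v) (V t ω)) = bR := by
      funext t ω
      rw [show (fun v ↦ g v) = g from rfl, deriv_const, zero_add, hg1 _ (hB ω t).1,
        hg2 _ (hB ω t).1]
    have e3 : (fun (t : ℝ≥0) ω ↦ σ' t ω * deriv (fun v ↦ g v) (V t ω)) = σR := by
      funext t ω
      rw [show (fun v ↦ g v) = g from rfl, hg1 _ (hB ω t).1]
    rw [e1, e2, e3] at hItoR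
    exact hItoR
  have hRa : StronglyAdapted brownianFiltration R := fun t ↦
    (hVa t).measurable.inv.stronglyMeasurable
  have hRc : ∀ ω, Continuous (R · ω) := fun ω ↦ (hVc ω).inv₀ fun s ↦ (hB ω s).2.2.2.1.ne'
  have hRprog : IsStronglyProgressive brownianFiltration R :=
    hRa.isStronglyProgressive_of_continuous hRc
  have hRbd : ∀ t ω, |R t ω| ≤ m⁻¹ := fun t ω ↦ by
    have h := (hB ω t).1
    simp only [hRdef]
    rw [abs_of_pos (inv_pos.2 (hm.trans_le h.1))]
    exact inv_anti₀ hm h.1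
  have hσR : IsStronglyProgressive brownianFiltration σR :=
    hσ'.mul (fun i ↦ ((hVprog i).measurable.pow_const 2).inv.neg.stronglyMeasurable)
  have hσRbd : ∀ t ω, |σR t ω| ≤ Real.sqrt κ * (m ^ 2)⁻¹ := by
    intro t ω
    have h := (hB ω t).1
    have hm2 : m ^ 2 ≤ V t ω ^ 2 := pow_le_pow_left₀ hm.le h.1 2
    simp only [hσRdef, abs_mul, abs_neg, abs_inv, abs_pow]
    rw [abs_of_pos (hm.trans_le h.1)]
    exact mul_le_mul (hσ'bd t ω) (inv_anti₀ (pow_pos hm 2) hm2) (by positivity) (Real.sqrt_nonneg _)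
  /- Step 2: the finite-variation processes `E = D₀₁D₀₂/D₁₂` and `q = D₀₁/D₁₂`. -/
  set E : ℝ≥0 → (ℝ≥0 → ℝ) → ℝ := fun t ω ↦
    (V₁ t ω - V t ω) * (V₂ t ω - V t ω) / (V₂ t ω - V₁ t ω) with hEdef
  set q : ℝ≥0 → (ℝ≥0 → ℝ) → ℝ := fun t ω ↦ (V₁ t ω - V t ω) / (V₂ t ω - V₁ t ω) with hqdef
  set e : ℝ≥0 → (ℝ≥0 → ℝ) → ℝ := trunc ρ fun s ω ↦
    (G₀₁ s ω * (V₂ s ω - V s ω) + (V₁ s ω - V s ω) * G₀₂ s ω) / (V₂ s ω - V₁ s ω) -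
      (V₁ s ω - V s ω) * (V₂ s ω - V s ω) * G₁₂ s ω / (V₂ s ω - V₁ s ω) ^ 2 with hedef
  set q' : ℝ≥0 → (ℝ≥0 → ℝ) → ℝ := trunc ρ fun s ω ↦
    (G₀₁ s ω * 1 + (V₁ s ω - V s ω) * 0) / (V₂ s ω - V₁ s ω) -
      (V₁ s ω - V s ω) * 1 * G₁₂ s ω / (V₂ s ω - V₁ s ω) ^ 2 with hq'def
  have hErep : ∀ ω t, E t ω = E 0 ω + ∫ s in (0 : ℝ)..t, e s.toNNReal ω := by
    intro ω t
    have hne : ∀ s, (x 2 - x 1) + timeIntegral (trunc ρ G₁₂) s ω ≠ 0 := fun s ↦ by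
      rw [← (hgap ω s).2]; exact (hd.trans_le (hB ω s).2.2.1.1).ne'
    have h := mul_div_eq_add_timeIntegral (c₁ := x 1 - x 0) (c₂ := x 2 - x 0) (c₃ := x 2 - x 1)
      (hG₀₁c ω) (hG₀₂c ω) (hG₁₂c ω) hne t
    have hE : ∀ s, E s ω = ((x 1 - x 0) + timeIntegral (trunc ρ G₀₁) s ω) *
        ((x 2 - x 0) + timeIntegral (trunc ρ G₀₂) s ω) /
        ((x 2 - x 1) + timeIntegral (trunc ρ G₁₂) s ω) := fun s ↦ by
      simp only [hEdef]; rw [(hgap ω s).1, (hgap ω s).2, hgap₀₂ ω s]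
    have hE0 : E 0 ω = (x 1 - x 0) * (x 2 - x 0) / (x 2 - x 1) := by
      rw [hE 0]; simp [timeIntegral]
    have he : (trunc ρ fun s ω ↦
        (G₀₁ s ω * ((x 2 - x 0) + timeIntegral (trunc ρ G₀₂) s ω) +
            ((x 1 - x 0) + timeIntegral (trunc ρ G₀₁) s ω) * G₀₂ s ω) /
          ((x 2 - x 1) + timeIntegral (trunc ρ G₁₂) s ω) -
        ((x 1 - x 0) + timeIntegral (trunc ρ G₀₁) s ω) *
          ((x 2 - x 0) + timeIntegral (trunc ρ G₀₂) s ω) * G₁₂ s ω /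
          ((x 2 - x 1) + timeIntegral (trunc ρ G₁₂) s ω) ^ 2) = e := by
      simp only [hedef]
      congr 1
      funext s ω'
      rw [← (hgap ω' s).1, ← (hgap ω' s).2, ← hgap₀₂ ω' s]
    rw [hE t, hE0, h, he]
    rfl
  have hqrep : ∀ ω t, q t ω = q 0 ω + ∫ s in (0 : ℝ)..t, q' s.toNNReal ω := by
    intro ω t
    have hne : ∀ s, (x 2 - x 1) + timeIntegral (trunc ρ G₁₂) s ω ≠ 0 := fun s ↦ by
      rw [← (hgap ω s).2]; exact (hd.trans_le (hB ω s).2.2.1.1).ne'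
    have htz : ∀ (s : ℝ≥0) (ω' : ℝ≥0 → ℝ),
        timeIntegral (trunc ρ fun (_ : ℝ≥0) (_ : ℝ≥0 → ℝ) ↦ (0 : ℝ)) s ω' = 0 := by
      intro s ω'
      simp [timeIntegral, trunc_apply]
    have h := mul_div_eq_add_timeIntegral (c₁ := x 1 - x 0) (c₂ := (1 : ℝ)) (c₃ := x 2 - x 1)
      (G₂ := fun (_ : ℝ≥0) (_ : ℝ≥0 → ℝ) ↦ (0 : ℝ)) (hG₀₁c ω) continuous_const (hG₁₂c ω) hne t
    have hq : ∀ s, q s ω = ((x 1 - x 0) + timeIntegral (trunc ρ G₀₁) s ω) *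
        (1 + timeIntegral (trunc ρ fun (_ : ℝ≥0) (_ : ℝ≥0 → ℝ) ↦ (0 : ℝ)) s ω) /
        ((x 2 - x 1) + timeIntegral (trunc ρ G₁₂) s ω) := fun s ↦ by
      simp only [hqdef]; rw [(hgap ω s).1, (hgap ω s).2, htz, add_zero, mul_one]
    have hq0 : q 0 ω = (x 1 - x 0) * 1 / (x 2 - x 1) := by
      rw [hq 0]; simp [timeIntegral]
    have hq'' : (trunc ρ fun s ω ↦
        (G₀₁ s ω * (1 + timeIntegral (trunc ρ fun (_ : ℝ≥0) (_ : ℝ≥0 → ℝ) ↦ (0 : ℝ)) s ω) +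
            ((x 1 - x 0) + timeIntegral (trunc ρ G₀₁) s ω) *
              (fun (_ : ℝ≥0) (_ : ℝ≥0 → ℝ) ↦ (0 : ℝ)) s ω) /
          ((x 2 - x 1) + timeIntegral (trunc ρ G₁₂) s ω) -
        ((x 1 - x 0) + timeIntegral (trunc ρ G₀₁) s ω) *
          (1 + timeIntegral (trunc ρ fun (_ : ℝ≥0) (_ : ℝ≥0 → ℝ) ↦ (0 : ℝ)) s ω) * G₁₂ s ω /
          ((x 2 - x 1) + timeIntegral (trunc ρ G₁₂) s ω) ^ 2) = q' := by
      simp only [hq'def]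
      congr 1
      funext s ω'
      rw [← (hgap ω' s).1, ← (hgap ω' s).2, htz, add_zero]
    rw [hq t, hq0, h, hq'']
    rfl
  -- local integrability, adaptedness, continuity, bounds of `E`, `q`, `e`, `q'`
  have hgapne : ∀ ω s, V₂ s ω - V₁ s ω ≠ 0 := fun ω s ↦ (hd.trans_le (hB ω s).2.2.1.1).ne'
  have hec : ∀ ω, Continuous fun s ↦
      (G₀₁ s ω * (V₂ s ω - V s ω) + (V₁ s ω - V s ω) * G₀₂ s ω) / (V₂ s ω - V₁ s ω) -
      (V₁ s ω - V s ω) * (V₂ s ω - V s ω) * G₁₂ s ω / (V₂ s ω - V₁ s ω) ^ 2 := by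
    intro ω
    refine ((((hG₀₁c ω).mul ((hV₂c ω).sub (hVc ω))).add (((hV₁c ω).sub (hVc ω)).mul
      (hG₀₂c ω))).div ((hV₂c ω).sub (hV₁c ω)) (hgapne ω)).sub ?_
    exact ((((hV₁c ω).sub (hVc ω)).mul ((hV₂c ω).sub (hVc ω))).mul (hG₁₂c ω)).div
      (((hV₂c ω).sub (hV₁c ω)).pow 2) fun s ↦ pow_ne_zero 2 (hgapne ω s)
  have hq'c : ∀ ω, Continuous fun s ↦
      (G₀₁ s ω * 1 + (V₁ s ω - V s ω) * 0) / (V₂ s ω - V₁ s ω) -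
      (V₁ s ω - V s ω) * 1 * G₁₂ s ω / (V₂ s ω - V₁ s ω) ^ 2 := by
    intro ω
    refine ((((hG₀₁c ω).mul continuous_const).add (((hV₁c ω).sub (hVc ω)).mul
      continuous_const)).div ((hV₂c ω).sub (hV₁c ω)) (hgapne ω)).sub ?_
    exact (((((hV₁c ω).sub (hVc ω)).mul continuous_const)).mul (hG₁₂c ω)).div
      (((hV₂c ω).sub (hV₁c ω)).pow 2) fun s ↦ pow_ne_zero 2 (hgapne ω s)
  have he_int : ∀ ω (t : ℝ≥0), IntegrableOn (fun s : ℝ ↦ e s.toNNReal ω) (Icc 0 t) := fun ω t ↦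
    integrableOn_trunc (((hec ω).comp continuous_real_toNNReal).continuousOn.integrableOn_compact
      isCompact_Icc)
  have hq'_int : ∀ ω (t : ℝ≥0), IntegrableOn (fun s : ℝ ↦ q' s.toNNReal ω) (Icc 0 t) := fun ω t ↦
    integrableOn_trunc (((hq'c ω).comp continuous_real_toNNReal).continuousOn.integrableOn_compact
      isCompact_Icc)
  have hEa : StronglyAdapted brownianFiltration E := fun t ↦
    ((((hV₁a t).measurable.sub (hVa t).measurable).mul
      ((hV₂a t).measurable.sub (hVa t).measurable)).div
      ((hV₂a t).measurable.sub (hV₁a t).measurable)).stronglyMeasurable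
  have hqa : StronglyAdapted brownianFiltration q := fun t ↦
    (((hV₁a t).measurable.sub (hVa t).measurable).div
      ((hV₂a t).measurable.sub (hV₁a t).measurable)).stronglyMeasurable
  have hEc : ∀ ω, Continuous (E · ω) := fun ω ↦
    (((hV₁c ω).sub (hVc ω)).mul ((hV₂c ω).sub (hVc ω))).div ((hV₂c ω).sub (hV₁c ω)) (hgapne ω)
  have hqc : ∀ ω, Continuous (q · ω) := fun ω ↦
    ((hV₁c ω).sub (hVc ω)).div ((hV₂c ω).sub (hV₁c ω)) (hgapne ω)
  have hEprog : IsStronglyProgressive brownianFiltration E :=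
    hEa.isStronglyProgressive_of_continuous hEc
  have hqprog : IsStronglyProgressive brownianFiltration q :=
    hqa.isStronglyProgressive_of_continuous hqc
  set Ehi : ℝ := (x 1 - x 0) * (x 2 - x 0) / d with hEhi
  have hEpos : ∀ t ω, 0 < E t ω := by
    intro t ω
    obtain ⟨-, h01', h12', hVpos, hVV₁, hV₁V₂⟩ := hB ω t
    exact div_pos (mul_pos (by linarith) (by linarith)) (by linarith)
  have hEbd : ∀ t ω, |E t ω| ≤ Ehi := by
    intro t ω
    obtain ⟨-, h01', h12', hVpos, hVV₁, hV₁V₂⟩ := hB ω t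
    have hD₀₁ : 0 < V₁ t ω - V t ω := by linarith
    have hD₀₂ : 0 < V₂ t ω - V t ω := by linarith
    have hD₁₂ : d ≤ V₂ t ω - V₁ t ω := h12'.1
    rw [abs_of_pos (hEpos t ω)]
    simp only [hEdef, hEhi]
    rw [div_le_div_iff₀ (hd.trans_le hD₁₂) hd]
    have h1 : V₁ t ω - V t ω ≤ x 1 - x 0 := h01'.2
    have h2 : V₂ t ω - V t ω ≤ x 2 - x 0 := by linarith [h12'.2]
    calc (V₁ t ω - V t ω) * (V₂ t ω - V t ω) * d
        ≤ (x 1 - x 0) * (x 2 - x 0) * d := by gcongr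
      _ ≤ (x 1 - x 0) * (x 2 - x 0) * (V₂ t ω - V₁ t ω) := by
          have : 0 ≤ (x 1 - x 0) * (x 2 - x 0) := mul_nonneg (by linarith) (by linarith)
          exact mul_le_mul_of_nonneg_left hD₁₂ this
  -- progressivity of the rates
  have hG₀₁prog : IsStronglyProgressive brownianFiltration G₀₁ := fun i ↦
    ((measurable_const.div (hV₁prog i).measurable).sub
      (measurable_const.div (hVprog i).measurable)).stronglyMeasurable
  have hG₁₂prog : IsStronglyProgressive brownianFiltration G₁₂ := fun i ↦
    ((measurable_const.div (hV₂prog i).measurable).sub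
      (measurable_const.div (hV₁prog i).measurable)).stronglyMeasurable
  have hG₀₂prog : IsStronglyProgressive brownianFiltration G₀₂ := hG₀₁prog.add hG₁₂prog
  have heprog : IsStronglyProgressive brownianFiltration e := by
    refine isStronglyProgressive_trunc (fun i ↦ ?_) hρ'
    have hV' := (hVprog i).measurable
    have hV₁' := (hV₁prog i).measurable
    have hV₂' := (hV₂prog i).measurable
    have hG₀₁' := (hG₀₁prog i).measurable
    have hG₁₂' := (hG₁₂prog i).measurable
    have hG₀₂' := (hG₀₂prog i).measurable
    exact ((((hG₀₁'.mul (hV₂'.sub hV')).add ((hV₁'.sub hV').mul hG₀₂')).div (hV₂'.sub hV₁')).sub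
      ((((hV₁'.sub hV').mul (hV₂'.sub hV')).mul hG₁₂').div ((hV₂'.sub hV₁').pow_const 2))).stronglyMeasurable
  have hq'prog : IsStronglyProgressive brownianFiltration q' := by
    refine isStronglyProgressive_trunc (fun i ↦ ?_) hρ'
    have hV' := (hVprog i).measurable
    have hV₁' := (hV₁prog i).measurable
    have hV₂' := (hV₂prog i).measurable
    have hG₀₁' := (hG₀₁prog i).measurable
    have hG₁₂' := (hG₁₂prog i).measurable
    exact ((((hG₀₁'.mul measurable_const).add ((hV₁'.sub hV').mul measurable_const)).div
      (hV₂'.sub hV₁')).sub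
      ((((hV₁'.sub hV').mul measurable_const).mul hG₁₂').div ((hV₂'.sub hV₁').pow_const 2))).stronglyMeasurable
  have hbVprog : IsStronglyProgressive brownianFiltration (trunc ρ fun s ω ↦ 2 / V s ω) :=
    isStronglyProgressive_trunc (fun i ↦ (measurable_const.div (hVprog i).measurable).stronglyMeasurable) hρ'
  have hbRprog : IsStronglyProgressive brownianFiltration bR := fun i ↦ by
    have hV' := (hVprog i).measurable
    have hb' := (hbVprog i).measurable
    have hσ'' := (hσ' i).measurable
    exact ((hb'.mul (hV'.pow_const 2).inv.neg).add
      ((measurable_const.mul (hσ''.pow_const 2)).mul (measurable_const.mul (hV'.pow_const 3).inv))).stronglyMeasurable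
  /- Step 3: `P = R E + q = (1 - η)/η` is an Itô process (product rule). -/
  obtain ⟨KX, hKX, hKXM, -⟩ := exists_isItoIntegral_of_sq_integrable (hσR.mul hRprog)
    (lintegral_lintegral_sq_ne_top_of_abs_le (C := fun _ ↦ Real.sqrt κ * (m ^ 2)⁻¹ * m⁻¹)
      fun t s ω _ ↦ by
        rw [abs_mul]
        exact mul_le_mul (hσRbd s ω) (hRbd s ω) (abs_nonneg _) (by positivity))
  obtain ⟨KE, hKE, hKEM, -⟩ := exists_isItoIntegral_of_sq_integrable (hσR.mul hEprog)
    (lintegral_lintegral_sq_ne_top_of_abs_le (C := fun _ ↦ Real.sqrt κ * (m ^ 2)⁻¹ * Ehi)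
      fun t s ω _ ↦ by
        rw [abs_mul]
        exact mul_le_mul (hσRbd s ω) (hEbd s ω) (abs_nonneg _) (by positivity))
  have hRE := IsItoProcess.mul_timeIntegral hRa hRc hσR hR hEa hEc
    (ae_of_all _ fun ω t ↦ hErep ω t) (ae_of_all _ fun ω t ↦ he_int ω t) hKX hKXM hKE hKEM
  have hP := hRE.add_const_mul_timeIntegral (A := q) (a := q')
    (ae_of_all _ fun ω t ↦ hqrep ω t) (ae_of_all _ fun ω t ↦ hq'_int ω t) 1
  set P : ℝ≥0 → (ℝ≥0 → ℝ) → ℝ := fun t ω ↦ R t ω * E t ω + 1 * q t ω with hPdef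
  set bP : ℝ≥0 → (ℝ≥0 → ℝ) → ℝ := fun t ω ↦ R t ω * e t ω + E t ω * bR t ω + 1 * q' t ω
    with hbPdef
  set σP : ℝ≥0 → (ℝ≥0 → ℝ) → ℝ := fun t ω ↦ σR t ω * E t ω with hσPdef
  have hP' : IsItoProcess P bP σP brownian brownianFiltration preWienerMeasure := hP
  have hPeq : ∀ t ω, P t ω = (V₁ t ω - V t ω) * V₂ t ω / ((V₂ t ω - V₁ t ω) * V t ω) := by
    intro t ω
    obtain ⟨-, -, -, hVpos, hVV₁, hV₁V₂⟩ := hB ω t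
    have h1 : V t ω ≠ 0 := hVpos.ne'
    have h2 : V₂ t ω - V₁ t ω ≠ 0 := by linarith
    simp only [hPdef, hRdef, hEdef, hqdef]
    field_simp
    ring
  have hPa : StronglyAdapted brownianFiltration P := fun t ↦
    ((hRa t).mul (hEa t)).add ((stronglyMeasurable_const (b := (1 : ℝ))).mul (hqa t))
  have hPc : ∀ ω, Continuous (P · ω) := fun ω ↦
    ((hRc ω).mul (hEc ω)).add (continuous_const.mul (hqc ω))
  have hbPprog : IsStronglyProgressive brownianFiltration bP :=
    ((hRprog.mul heprog).add (hEprog.mul hbRprog)).add ((isStronglyProgressive_const _ _).mul hq'prog)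
  have hσP : IsStronglyProgressive brownianFiltration σP := hσR.mul hEprog
  have hσPbd : ∀ t ω, |σP t ω| ≤ Real.sqrt κ * (m ^ 2)⁻¹ * Ehi := fun t ω ↦ by
    simp only [hσPdef]
    rw [abs_mul]
    exact mul_le_mul (hσRbd t ω) (hEbd t ω) (abs_nonneg _) (by positivity)
  -- the range of `P`
  set Plo : ℝ := d * (m + 2 * d) / ((x 2 - x 1) * M) with hPlo
  set Phi : ℝ := (x 1 - x 0) * (M + (x 2 - x 0)) / (d * m) with hPhi
  have hM : 0 < M := hx0.trans hxM
  have hPlopos : 0 < Plo := div_pos (mul_pos hd (by linarith)) (mul_pos (by linarith) hM)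
  have hPhipos : 0 < (x 1 - x 0) * (M + (x 2 - x 0)) := mul_pos (by linarith) (by linarith)
  have hPmem : ∀ t ω, P t ω ∈ Icc Plo Phi := by
    intro t ω
    obtain ⟨hVm, h01', h12', hVpos, hVV₁, hV₁V₂⟩ := hB ω t
    rw [hPeq t ω]
    have hD₁₂ : 0 < V₂ t ω - V₁ t ω := by linarith
    have hden : 0 < (V₂ t ω - V₁ t ω) * V t ω := mul_pos hD₁₂ hVpos
    constructor
    · simp only [hPlo]
      rw [div_le_div_iff₀ (mul_pos (by linarith) hM) hden]
      have h1 : d * (m + 2 * d) ≤ (V₁ t ω - V t ω) * V₂ t ω :=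
        mul_le_mul h01'.1 (by linarith [hVm.1, h01'.1, h12'.1]) (by positivity) (by linarith [h01'.1])
      have h2 : (V₂ t ω - V₁ t ω) * V t ω ≤ (x 2 - x 1) * M :=
        mul_le_mul h12'.2 hVm.2 hVpos.le (by linarith)
      calc d * (m + 2 * d) * ((V₂ t ω - V₁ t ω) * V t ω)
          ≤ (V₁ t ω - V t ω) * V₂ t ω * ((V₂ t ω - V₁ t ω) * V t ω) :=
            mul_le_mul_of_nonneg_right h1 hden.le
        _ ≤ (V₁ t ω - V t ω) * V₂ t ω * ((x 2 - x 1) * M) :=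
            mul_le_mul_of_nonneg_left h2 (by nlinarith)
    · simp only [hPhi]
      rw [div_le_div_iff₀ hden (mul_pos hd hm)]
      have h1 : (V₁ t ω - V t ω) * V₂ t ω ≤ (x 1 - x 0) * (M + (x 2 - x 0)) :=
        mul_le_mul h01'.2 (by linarith [hVm.2, h01'.2, h12'.2]) (by linarith) (by linarith)
      have h2 : d * m ≤ (V₂ t ω - V₁ t ω) * V t ω :=
        mul_le_mul h12'.1 hVm.1 hm.le hD₁₂.le
      calc (V₁ t ω - V t ω) * V₂ t ω * (d * m)
          ≤ (x 1 - x 0) * (M + (x 2 - x 0)) * (d * m) :=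
            mul_le_mul_of_nonneg_right h1 (mul_pos hd hm).le
        _ ≤ (x 1 - x 0) * (M + (x 2 - x 0)) * ((V₂ t ω - V₁ t ω) * V t ω) :=
            mul_le_mul_of_nonneg_left h2 (by nlinarith)
  have hPlohi : Plo ≤ Phi := (hPmem 0 (fun _ ↦ 0)).1.trans (hPmem 0 (fun _ ↦ 0)).2
  have hV0 : ∀ ω, V 0 ω = x 0 ∧ V₁ 0 ω = x 1 ∧ V₂ 0 ω = x 2 := fun ω ↦ by
    refine ⟨?_, ?_, ?_⟩
    · show stoppedProcess X₀ ρ 0 ω = x 0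
      rw [stoppedProcess_eq_of_le (coe_zero_le_withTop _)]
      exact sleRealFlowStop_zero_apply hx0.ne' ω
    · show stoppedProcess X₁ ρ 0 ω = x 1
      rw [stoppedProcess_eq_of_le (coe_zero_le_withTop _)]
      exact sleRealFlowStop_zero_apply hx1.ne' ω
    · show stoppedProcess X₂ ρ 0 ω = x 2
      rw [stoppedProcess_eq_of_le (coe_zero_le_withTop _)]
      exact sleRealFlowStop_zero_apply hx2.ne' ω
  have hP0 : ∀ ω, P 0 ω = (x 1 - x 0) * x 2 / ((x 2 - x 1) * x 0) := fun ω ↦ by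
    rw [hPeq 0 ω, (hV0 ω).1, (hV0 ω).2.1, (hV0 ω).2.2]
  /- Step 4: Itô's formula for a `C²` modification of `G(p) = F(1/(1+p))` along `P`. -/
  obtain ⟨Gt, hGt, hGteq, -⟩ := exists_contDiff_eqOn_Icc (n := 2) (a := Plo / 4) (b := 2 * Phi + 1)
    (lo := Plo / 2) (hi := 2 * Phi) (by linarith) (by linarith) (by linarith)
    (contDiffOn_cardyFunction_comp_inv.mono fun p hp ↦ lt_trans (by linarith) hp.1)
  have hGtnhds : ∀ p ∈ Icc Plo Phi, Gt =ᶠ[𝓝 p] fun p ↦ cardyFunction (1 + p)⁻¹ := by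
    intro p hp
    have hmem : Ioo (Plo / 2) (2 * Phi) ∈ 𝓝 p :=
      Ioo_mem_nhds (by linarith [hp.1]) (by linarith [hp.2])
    filter_upwards [hmem] with u hu
    exact hGteq (Ioo_subset_Icc_self hu)
  have hGt0 : ∀ p ∈ Icc Plo Phi, Gt p = cardyFunction (1 + p)⁻¹ := fun p hp ↦
    hGteq ⟨by linarith [hp.1], by linarith [hp.2]⟩
  have hGt1 : ∀ p ∈ Icc Plo Phi, deriv Gt p = -(cardyDerivF (1 + p)⁻¹ * ((1 + p)⁻¹) ^ 2) := by
    intro p hp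
    rw [(hGtnhds p hp).deriv_eq]
    exact (hasDerivAt_cardyFunction_comp_inv (hPlopos.trans_le hp.1)).1.deriv
  have hGt2 : ∀ p ∈ Icc Plo Phi, iteratedDeriv 2 Gt p =
      (-(2 / 3) * (1 - 2 * (1 + p)⁻¹) / ((1 + p)⁻¹ * (1 - (1 + p)⁻¹)) * cardyDerivF (1 + p)⁻¹) *
          ((1 + p)⁻¹) ^ 4 + 2 * cardyDerivF (1 + p)⁻¹ * ((1 + p)⁻¹) ^ 3 := by
    intro p hp
    rw [iteratedDeriv_succ, iteratedDeriv_one]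
    have h1 : deriv Gt =ᶠ[𝓝 p] fun u ↦ -(cardyDerivF (1 + u)⁻¹ * ((1 + u)⁻¹) ^ 2) := by
      have hmem : Ioo (Plo / 2) (2 * Phi) ∈ 𝓝 p :=
        Ioo_mem_nhds (by linarith [hp.1]) (by linarith [hp.2])
      filter_upwards [(hGtnhds p hp).deriv, hmem] with u hu hu'
      rw [hu]
      exact (hasDerivAt_cardyFunction_comp_inv (by linarith [hu'.1])).1.deriv
    rw [h1.deriv_eq]
    exact (hasDerivAt_cardyFunction_comp_inv (hPlopos.trans_le hp.1)).2.deriv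
  have hmart := martingale_apply_sub_timeIntegral hGt hPa hPc hbPprog hσP hP' hP0 hPmem hσPbd
  /- Step 5: identify `G̃(P) = F(η)` and the drift. -/
  have hηeq : ∀ t ω, (1 + P t ω)⁻¹ = cardyEta (V t ω) (V₁ t ω) (V₂ t ω) := by
    intro t ω
    obtain ⟨-, -, -, hVpos, hVV₁, hV₁V₂⟩ := hB ω t
    have h1 : V t ω ≠ 0 := hVpos.ne'
    have h2 : V₂ t ω - V₁ t ω ≠ 0 := by linarith
    have h3 : V₁ t ω ≠ 0 := by linarith
    have h4 : V₂ t ω - V t ω ≠ 0 := by linarith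
    have h5 : (V₂ t ω - V₁ t ω) * V t ω + (V₁ t ω - V t ω) * V₂ t ω ≠ 0 := by
      have : (V₂ t ω - V₁ t ω) * V t ω + (V₁ t ω - V t ω) * V₂ t ω = V₁ t ω * (V₂ t ω - V t ω) := by
        ring
      rw [this]; exact mul_ne_zero h3 h4
    rw [hPeq t ω, cardyEta, inv_eq_iff_eq_inv]
    field_simp
    ring
  have hdrift : (fun s ω ↦ bP s ω * deriv Gt (P s ω) + 2⁻¹ * σP s ω ^ 2 * iteratedDeriv 2 Gt (P s ω)) =
      trunc ρ fun s ω ↦ cardyDrift κ (X₀ s ω) (X₁ s ω) (X₂ s ω) := by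
    funext s ω
    by_cases hs : (s : WithTop ℝ≥0) ≤ ρ ω
    · rw [trunc_of_le hs, hGt1 _ (hPmem s ω), hGt2 _ (hPmem s ω), hηeq s ω]
      obtain ⟨-, -, -, hVpos, hVV₁, hV₁V₂⟩ := hB ω s
      have hVs : V s ω = X₀ s ω := stoppedProcess_eq_of_le hs
      have hV₁s : V₁ s ω = X₁ s ω := stoppedProcess_eq_of_le hs
      have hV₂s : V₂ s ω = X₂ s ω := stoppedProcess_eq_of_le hs
      have es : e s ω = (G₀₁ s ω * (V₂ s ω - V s ω) + (V₁ s ω - V s ω) * G₀₂ s ω) /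
          (V₂ s ω - V₁ s ω) - (V₁ s ω - V s ω) * (V₂ s ω - V s ω) * G₁₂ s ω /
          (V₂ s ω - V₁ s ω) ^ 2 := by rw [hedef]; exact trunc_of_le hs
      have q's : q' s ω = (G₀₁ s ω * 1 + (V₁ s ω - V s ω) * 0) / (V₂ s ω - V₁ s ω) -
          (V₁ s ω - V s ω) * 1 * G₁₂ s ω / (V₂ s ω - V₁ s ω) ^ 2 := by
        rw [hq'def]; exact trunc_of_le hs
      have σ's : σ' s ω = -Real.sqrt κ := by rw [hσ'def]; exact trunc_of_le hs
      have bVs : trunc ρ (fun s ω ↦ 2 / V s ω) s ω = 2 / V s ω := trunc_of_le hs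
      simp only [hVs, hV₁s, hV₂s] at hVpos hVV₁ hV₁V₂
      simp only [hbPdef, hσPdef, hσRdef, hbRdef, hRdef, hEdef, es, q's, σ's, bVs, hG₀₂def, hG₀₁def,
        hG₁₂def, hVs, hV₁s, hV₂s]
      exact cardy_drift_identity κ hVpos.ne' (by linarith) (by linarith) (by linarith) (by linarith)
        (by linarith)
    · rw [trunc_of_not_le hs]
      have e0 : e s ω = 0 := by rw [hedef]; exact trunc_of_not_le hs
      have q'0 : q' s ω = 0 := by rw [hq'def]; exact trunc_of_not_le hs
      have σ'0 : σ' s ω = 0 := by rw [hσ'def]; exact trunc_of_not_le hs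
      have bV0 : trunc ρ (fun s ω ↦ 2 / V s ω) s ω = 0 := trunc_of_not_le hs
      simp only [hbPdef, hσPdef, hσRdef, hbRdef, e0, q'0, σ'0, bV0]
      ring
  have heq : (fun t ω ↦ cardyFunction (cardyEta (V t ω) (V₁ t ω) (V₂ t ω)) -
      timeIntegral (trunc ρ fun s ω ↦ cardyDrift κ (X₀ s ω) (X₁ s ω) (X₂ s ω)) t ω) =
      fun t ω ↦ Gt (P t ω) - timeIntegral (fun s ω ↦ bP s ω * deriv Gt (P s ω) +
        2⁻¹ * σP s ω ^ 2 * iteratedDeriv 2 Gt (P s ω)) t ω := by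
    rw [hdrift]
    funext t ω
    rw [hGt0 _ (hPmem t ω), hηeq t ω]
  rw [heq]
  exact hmart

end Main

end Literature.Probability.RandomPlanarGeometry
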